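import Summits.QuantumFields.BalabanUV.T4Continuum.Support.NE9BridgeSizeInduction
import Summits.QuantumFields.BalabanUV.T4Continuum.Support.NE9PencilEndSharpVacuum
import Literature.MathematicalPhysics.QuantumFieldTheory.Balaban1983to89.T4HistoryLipschitzWitness

/-!
# NE9PencilSizeInduction — route R3′'s OCCUPATION and TERM SIZES from the pencil binder `PotentialKPG` ALONE (KP for `m`, not `2m`):
# the size of the new term at every table of the ball, END #1's vacuum-subtracted size induction re-run on it, and the owner's
# record-shape sharp END (`NE9PencilEndSharpVacuum`, p256132) with its occupation hypothesis DERIVED — no `TwoPointKP`, no `hkp2`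

Cell `pub-balaban`, T4-DAG §6 row NE9; NE9 crux team (coordinator ruling «YM REDIRECT» e34b3e0c (2)), leaf lineage
`b2b-balaban-t4-ne9-formalise-leaf-06` generation 39; route R3′ «pencil ∕ potential-KPG» of `t4/ROUTES-NE9.md` v7.  CONTEXT: the refuter's
`PRICING-NE9.md` v9.0.1 01c7bf0c20a1bcb8 — finding F-v9-2 «INSTANCE PARITY of the co-leads» (both record ENDs consume (R-0)[scope], KP(2m), decay, pin
budget B, p̄₀, room, occupation) and question Q-v9-1 ∕ tripwire T18 «can R3′'s `hocc` (and (L)) be had without `hK : TwoPointKP` — a size induction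
on `PotentialKPG`'s KP(m) alone?  “yes, decl X” is T18 (R3′'s instance list becomes KP(m) ⊊ R4's KP(2m))».  THIS FILE is «yes, decl X» for the
OCCUPATION half (journal INTENT 3 l.29513): the size of a pinned cluster sum at a table INSIDE the ball needs only the majorant `m` there and KP for
`m` (`T4ActivityLipschitz.norm_clusterSum_le_of_kp ∘ kpd_of_norm_le` — the Literature's `norm_newTerm_le_of_potentialKP` :334, here in the Gâteaux
letters of `PotentialKPG`, already in the tree as `T4HistoryLipschitzWitness.norm_newTerm_le_of_potentialKPG`), so END #1's strong induction `NE9BridgeSizeInduction.termSize_of_recursion_vacSub` runs VERBATIM with `hK : TwoPointKP`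
replaced by `hKP : PotentialKPG` + the inclusion `𝒜 k ⊆ ball 0 R₀` of the admissible sets; feeding its occupation conclusion into the owner's
`NE9PencilEndSharpVacuum.ne9_and_fadingMemory_of_potentialKPG_perStep_sharp_vac` (p256132) gives route R3′'s record-shape END at `c_eff = 2` whose
displayed analytic inputs are `PotentialKPG` (KP for `m`), decay, pin budget, the size data (B0)∕(XZ)∕(N′)∕(R′), the room `s₀ < R₀`, the box
`𝒜 k ⊆ closedBall 0 s₀`, the reading law and the COUPLING HALF `hlast` (the shared crux object D2, displayed as in p256132) — and NOTHING with `2m`.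
The (L) half is NOT claimed here: the COUPLING HALF's `hK : TwoPointKP` (KP for `2n`) ∕ `hCup` ∕ `hTcup` are UNTOUCHED wherever (L) is derived (END #1 §2, `NE9VacuumSubtractedBridgeSharp` §1, the owner's E131) — this file removes `TwoPointKP`∕KP(2m) from R3′'s OCCUPATION and SIZES only, and displays `hlast` (owner g61 l.29614: «GO as cut; state that the coupling half's `hK` is untouched»).

HONEST FRAMING (T4-DAG PAGE 1).  Rung (B)+1 of the FINITE-VOLUME T⁴ programme — NOT infinite volume, NOT a mass gap, NOT the Clay
problem.  NE9 (`T4OutputRate.NE9` ∧ `FadingMemory`) is a cell NEW ESTIMATE, NOT PRINTED in [I] = [Balaban1987RG1] (CMP **109**), [II] =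
[Balaban1988RG2Cluster] (CMP **116**), and NOT PROVED for Bałaban's E^{(j)} («NE9 ⇐ the named binders»; row WALLED ON A MODEL O-NE9-1; spine
PROVED 0∕9); a shorter displayed-input list in a CONDITIONAL END is not progress on the estimate itself.  HONEST DEPENDENCY (cell line, verbatim):
continuum YM on T⁴ ⇐ BetaPertH ∧ nine spine estimates (0/9 proved); BetaPertH ⇐ (D1) ∧ (D4) ∧ CAP+tail; G-an2-4 gates asym, D1 and NE2/3/4.
`FlowStep.BetaPertH`, (B), (B^μ) do not occur.  Bookkeeping over ABSTRACT carriers and the tree's own KP lemmas; no `def`, no Prop-valued definition,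
no estimate of any object of the series; [I]∕[II] are referred to for TYPES only (ABSOLUTE RULE).  0 sorry.

* §1 (by name) the size of the new term at every table of the ball from `PotentialKPG` (KP for `m`) is the Literature's
  `T4HistoryLipschitzWitness.norm_newTerm_le_of_potentialKPG` (`‖newTerm act k (g k) U X Q‖ ≤ B₀ k·e^{−κd(X)}` for `Q ∈ ball 0 R₀`) — imported.
* §2 [folklore] **`termSize_of_recursion_vacSub_potentialKPG`** — `NE9BridgeSizeInduction.termSize_of_recursion_vacSub`'s binder list with `hK`
  REPLACED by `hKP` + `h𝒜R : ∀ k, 𝒜 k ⊆ ball 0 R₀` ⊢ `TermSize E W κ N ∧ ∀ g g′ ∈ W, ∀ k, ρ k (T k g′ (E g)) ∈ 𝒜 k` (proof = the owner's strong induction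
  verbatim, the two pin-bounded new terms at `U` and `U₀` from `T4HistoryLipschitzWitness.norm_newTerm_le_of_potentialKPG`).
* §3 [folklore] **`ne9_and_fadingMemory_of_potentialKPG_vacSub_sizeInduction`** — p256132's `…_perStep_sharp_vac` with `hocc` DERIVED by §2 from the size
  data + `h𝒜 : ∀ k, 𝒜 k ⊆ closedBall 0 s₀`; `hlast` displayed ⊢ `TermSize E W κ N ∧ NE9 E W κ (prodModuli ℓ fun _ ↦ ω + 2·B/(R₀ − s₀)·τ̄) ∧ FadingMemory …`.
* §4 [folklore] **`ne9_and_fadingMemory_of_potentialKPG_vacSub_sizeInduction_psiOf`** — §3 at `Ψ := NE9EndApplied.ΨOf`, reading `readingρ wt`, `hΨv` by `rfl`.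
DISGUISE TEST: a strong induction on the creation step over generic KP cluster sums; no history beyond the displayed binders; not NE9.
WHAT THIS DOES NOT DO: touches no activity, no species, no estimate of Bałaban's; `PotentialKPG` ((R-0)[scope] on the table ball at every background),
decay, pin budget, size data, box, reading law, `hlast` stay DISPLAYED; the model O-NE9-1 and the display `z = p̄₀/B` untouched; the coupling half
(L) still carries whatever its own supplier displays (D2 — `NE9VacuumSubtractedBridge` §2 ∕ `NE9VacuumSubtractedBridgeSharp` §1 take `TwoPointKP` + `hCup`).

References (TYPES only): [Balaban1987RG1] T. Bałaban, CMP **109** (1987) 249–301 — (0.23) p. 256, (1.18) p. 263, (2.12)–(2.14) p. 268;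
[Balaban1988RG2Cluster] T. Bałaban, CMP **116** (1988) 1–22 — (1.36) p. 9, (2.14)–(2.15) p. 15, Lemma 3 (2.38) p. 20, (2.41) p. 21; [KoteckyPreiss1986]
CMP **103** (1986) 491–498.  Summits-side NEW work (LEAN PLACEMENT RULE); imports `NE9BridgeSizeInduction`, `NE9PencilEndSharpVacuum` (owner lineage) and Literature `T4HistoryLipschitzWitness`
BY NAME; modifies nothing; 0 sorry.  Value = route R3′'s displayed instance list on the potential-KPG path loses `TwoPointKP`∕KP(2m) for sizes and
occupation (refuter T18, occupation half), NOT summit progress.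
-/

noncomputable section

namespace Summit.QuantumFields.BalabanUV.T4Continuum.NE9PencilSizeInduction

open scoped BigOperators ENNReal
open Metric Set
open Literature.Probability.LatticeModels
open Literature.MathematicalPhysics.QuantumFieldTheory.Balaban1983to89
open Literature.MathematicalPhysics.QuantumFieldTheory.Balaban1983to89.T4OutputRate
open Literature.MathematicalPhysics.QuantumFieldTheory.Balaban1983to89.T4ActivityLipschitz
open Literature.MathematicalPhysics.QuantumFieldTheory.Balaban1983to89.T4HistoryLipschitzRecursion
open Literature.MathematicalPhysics.QuantumFieldTheory.Balaban1983to89.T4HistoryLipschitzOuter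
open Literature.MathematicalPhysics.QuantumFieldTheory.Balaban1983to89.T4HistoryLipschitzActivity
open Literature.MathematicalPhysics.QuantumFieldTheory.Balaban1983to89.T4HistoryLipschitzActivity (ClusterGeom)
open Literature.MathematicalPhysics.QuantumFieldTheory.Balaban1983to89.T4HistoryLipschitzSegment
open Summit.QuantumFields.BalabanUV.T4Continuum.NE9PencilEndSharpVacuum

section Pencil

variable {C : Carriers} (G : ClusterGeom C) {Bg : Type} {Pot : Type*} [NormedAddCommGroup Pot] [NormedSpace ℂ Pot]

/-! ## §1 (by name) The size of the new term at every table of the ball from `PotentialKPG` (KP for `m`) is the Literature's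
`T4HistoryLipschitzWitness.norm_newTerm_le_of_potentialKPG` — imported, not restated. -/

/-! ## §2 END #1's vacuum-subtracted size induction on `PotentialKPG` -/

/-- [folklore] **SIZE INDUCTION, VACUUM-SUBTRACTED, FROM POTENTIAL-KPG** — `NE9BridgeSizeInduction.termSize_of_recursion_vacSub`'s binder list with
`hK : TwoPointKP G W act 𝒜 n lip a d` REPLACED by the pencil binder `hKP : G.PotentialKPG W act m a d R₀` and the inclusion `h𝒜R : ∀ k, 𝒜 k ⊆ ball 0 R₀`
of the admissible sets in the table ball: from the admissible class, the class-level channel size `ChannelSizeNN`, the factorisation, POTENTIAL-KPG ∧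
decay ∧ pin budget, the representation `hreprV`, (B0) the base size, (XZ) `|explZ k U X| ≤ e^{−κd}·p₀ k`, (N′) `p₀ j + 2·B₀ j ≤ N (j+1)`, `hNnn` and
(R′) the read-out of the weighted output box into `𝒜 k`: EVERY history obeys `TermSize E W κ N` AND every occurring table is admissible.  Proof =
the owner's strong induction on the creation step VERBATIM, the new term at `U` and at `U₀` pin-bounded by `T4HistoryLipschitzWitness.norm_newTerm_le_of_potentialKPG` (KP for `m`; no `2m`). -/
theorem termSize_of_recursion_vacSub_potentialKPG {ι : Type} {E : Functional C Bg} {W : Set (ℕ → ℝ)}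
    {Adm : Set (Bg → C.Dom → ℝ)} {T : ℕ → (ℕ → ℝ) → (Bg → C.Dom → ℝ) → ι → ℝ} {Ψ : ℕ → ℝ → (ι → ℝ) → Bg → C.Dom → ℝ}
    {act : ℕ → ℝ → Bg → Pot → G.P → ℂ} {𝒜 : ℕ → Set Pot} {m : ℕ → ℝ → Bg → G.P → ℝ} {a d : G.P → ℝ}
    {δ : C.Dom → ℝ} {B₀ p₀ N : ℕ → ℝ} {κ R₀ : ℝ} {wt : ℕ → ι → ℝ} {τ : ℕ → ℕ → ℝ} (ρ : ℕ → (ι → ℝ) → Pot) (U₀ : Bg)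
    (explZ : ℕ → Bg → C.Dom → ℝ) (hAdm : AdmissibleTerms E W Adm) (hsize : ChannelSizeNN Adm T κ wt τ)
    (hfac : Factorises E W T Ψ) (hKP : G.PotentialKPG W act m a d R₀) (h𝒜R : ∀ k, 𝒜 k ⊆ ball (0 : Pot) R₀)
    (hdec : G.DecayExtract δ d) (hpin : G.PinBudget a δ B₀ κ)
    (hreprV : ∀ (k : ℕ) (s : ℝ) (P : ι → ℝ) (U : Bg) (X : C.Dom),
      Ψ k s P U X = (G.newTerm act k s U X (ρ k P)).re - (G.newTerm act k s U₀ X (ρ k P)).re + explZ k U X)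
    (hexplZ : ∀ (k : ℕ) (U : Bg) (X : C.Dom), C.scale X = k + 1 → |explZ k U X| ≤ Real.exp (-(κ * C.d X)) * p₀ k)
    (hbase : ∀ g ∈ W, ∀ (U : Bg) (X : C.Dom), C.scale X = 0 → |E g U X| ≤ Real.exp (-(κ * C.d X)) * N 0)
    (hNsucc : ∀ j, p₀ j + 2 * B₀ j ≤ N (j + 1)) (hNnn : ∀ j, 0 ≤ N j)
    (hbox : ∀ (k : ℕ) (P : ι → ℝ), (∀ y, |P y| ≤ wt k y * sizeRadius τ N k) → ρ k P ∈ 𝒜 k) :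
    TermSize E W κ N ∧ ∀ g ∈ W, ∀ g' ∈ W, ∀ k : ℕ, ρ k (T k g' (E g)) ∈ 𝒜 k := by
  have main : ∀ (n : ℕ), ∀ g ∈ W, ∀ (U : Bg) (X : C.Dom), C.scale X ≤ n →
      |E g U X| ≤ Real.exp (-(κ * C.d X)) * N (C.scale X) := by
    intro n
    induction n with
    | zero =>
        intro g hg U X hX
        have h0 : C.scale X = 0 := Nat.le_zero.mp hX
        rw [h0]
        exact hbase g hg U X h0
    | succ k ih =>
        intro g hg U X hX
        rcases Nat.lt_or_ge (C.scale X) (k + 1) with hlt | hge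
        · exact ih g hg U X (Nat.lt_succ_iff.mp hlt)
        · have hXk : C.scale X = k + 1 := le_antisymm hX hge
          have hocc : ρ k (T k g (E g)) ∈ 𝒜 k :=
            hbox k _ fun y => hsize k g (E g) (hAdm.1 g hg) N hNnn (fun U' X' hX' => ih g hg U' X' hX') y
          have hnew : ∀ V : Bg, |(G.newTerm act k (g k) V X (ρ k (T k g (E g)))).re| ≤ B₀ k * Real.exp (-(κ * C.d X)) :=
            fun V => (Complex.abs_re_le_norm _).trans
              (T4HistoryLipschitzWitness.norm_newTerm_le_of_potentialKPG G hKP hdec hpin hg hXk (U := V) (h𝒜R k hocc))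
          have he := hexplZ k U X hXk
          rw [hfac g hg k U X hXk, hXk, hreprV]
          calc |(G.newTerm act k (g k) U X (ρ k (T k g (E g)))).re - (G.newTerm act k (g k) U₀ X (ρ k (T k g (E g)))).re +
                  explZ k U X|
              ≤ |(G.newTerm act k (g k) U X (ρ k (T k g (E g)))).re - (G.newTerm act k (g k) U₀ X (ρ k (T k g (E g)))).re| +
                  |explZ k U X| := abs_add_le _ _
            _ ≤ (|(G.newTerm act k (g k) U X (ρ k (T k g (E g)))).re| +
                  |(G.newTerm act k (g k) U₀ X (ρ k (T k g (E g)))).re|) + |explZ k U X| :=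
                add_le_add (abs_sub _ _) le_rfl
            _ ≤ (B₀ k * Real.exp (-(κ * C.d X)) + B₀ k * Real.exp (-(κ * C.d X))) + Real.exp (-(κ * C.d X)) * p₀ k :=
                add_le_add (add_le_add (hnew U) (hnew U₀)) he
            _ = Real.exp (-(κ * C.d X)) * (p₀ k + 2 * B₀ k) := by ring
            _ ≤ Real.exp (-(κ * C.d X)) * N (k + 1) := mul_le_mul_of_nonneg_left (hNsucc k) (Real.exp_nonneg _)
  have hT : TermSize E W κ N := fun g hg U X => main (C.scale X) g hg U X le_rfl
  exact ⟨hT, fun g hg g' _ k => hbox k _ fun y => hsize k g' (E g) (hAdm.1 g hg) N hNnn (fun U X _ => hT g hg U X) y⟩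

/-! ## §3 Route R3′'s record-shape END at `c_eff = 2` with the occupation DERIVED — no `TwoPointKP`, no KP(2m) -/

/-- [folklore] **NE9 ∧ FADING MEMORY ∧ THE TERM SIZE BOUND ON THE POTENTIAL-KPG PATH, OCCUPATION DERIVED** — the owner's
`NE9PencilEndSharpVacuum.ne9_and_fadingMemory_of_potentialKPG_perStep_sharp_vac` (p256132: rate `ω + 2·B/(R₀ − s₀)·τ̄`, `hΨv` the vacuum-subtracted
representation, `hlast` the displayed coupling half) with its occupation hypothesis `hocc : ‖ρ k (T k g′ (E g))‖ ≤ s₀` DERIVED by §2 from the size data (B0)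
`hbase`, (XZ) `hexplZ`, (N′) `hNsucc : p₀ j + 2B ≤ N (j+1)`, `hNnn`, (R′) `hbox` and the box `h𝒜 : 𝒜 k ⊆ closedBall 0 s₀` (`s₀ < R₀`).  Displayed analytic
inputs: `PotentialKPG` (KP for `m`), decay, pin budget, size data, room, box, reading law, `hlast` — nothing with `2m`.  Returns `TermSize E W κ N` too. -/
theorem ne9_and_fadingMemory_of_potentialKPG_vacSub_sizeInduction {ι : Type} {E : Functional C Bg} {W : Set (ℕ → ℝ)}
    {Adm : Set (Bg → C.Dom → ℝ)} {T : ℕ → (ℕ → ℝ) → (Bg → C.Dom → ℝ) → ι → ℝ}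
    {Ψ : ℕ → ℝ → (ι → ℝ) → Bg → C.Dom → ℝ} {act : ℕ → ℝ → Bg → Pot → G.P → ℂ} {𝒜 : ℕ → Set Pot}
    {m : ℕ → ℝ → Bg → G.P → ℝ} {a d : G.P → ℝ} {δ : C.Dom → ℝ} {κ s₀ R₀ B ℓ τbar ω : ℝ} {wt : ℕ → ι → ℝ}
    {τ : ℕ → ℕ → ℝ} {lam : ℕ → ℝ} {p₀ N : ℕ → ℝ} (ρ : ℕ → (ι → ℝ) → Pot) (U₀ : Bg) (explZ : ℕ → Bg → C.Dom → ℝ)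
    (h0 : ScaleZeroFree E W) (hAdm : AdmissibleTerms E W Adm) (hres : AdmRestrict Adm) (hadd : ChannelAdditive Adm T)
    (hsum : ChannelStepSum Adm T) (hstep : ChannelSizeAtStepNN Adm T κ wt τ) (hfac : Factorises E W T Ψ)
    (hlast : LastCouplingLipschitz E W T Ψ κ lam) (hKP : G.PotentialKPG W act m a d R₀) (hdec : G.DecayExtract δ d)
    (hpin : G.PinBudget a δ (fun _ => B) κ) (hsR : s₀ < R₀) (h𝒜 : ∀ k, 𝒜 k ⊆ closedBall (0 : Pot) s₀)
    (hρ : ∀ (k : ℕ) (P P' : ι → ℝ) (M : ℝ), (∀ y, |P y - P' y| ≤ wt k y * M) → ‖ρ k P - ρ k P'‖ ≤ M)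
    (hΨv : ∀ (k : ℕ) (s : ℝ) (P : ι → ℝ) (U : Bg) (X : C.Dom),
      Ψ k s P U X = (G.newTerm act k s U X (ρ k P)).re - (G.newTerm act k s U₀ X (ρ k P)).re + explZ k U X)
    -- the size-induction data (B0), (XZ), (N′), (R′) — in place of the occupation hypothesis `hocc`
    (hexplZ : ∀ (k : ℕ) (U : Bg) (X : C.Dom), C.scale X = k + 1 → |explZ k U X| ≤ Real.exp (-(κ * C.d X)) * p₀ k)
    (hbase : ∀ g ∈ W, ∀ (U : Bg) (X : C.Dom), C.scale X = 0 → |E g U X| ≤ Real.exp (-(κ * C.d X)) * N 0)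
    (hNsucc : ∀ j, p₀ j + 2 * B ≤ N (j + 1)) (hNnn : ∀ j, 0 ≤ N j)
    (hbox : ∀ (k : ℕ) (P : ι → ℝ), (∀ y, |P y| ≤ wt k y * sizeRadius τ N k) → ρ k P ∈ 𝒜 k)
    (hℓ : 0 ≤ ℓ) (hB : 0 ≤ B) (hτbar : 0 ≤ τbar) (hω : 0 ≤ ω) (hpos : 0 < ω + 2 * B / (R₀ - s₀) * τbar)
    (hlam : ∀ k, lam k ≤ ℓ) (hτ : ∀ k j, j ≤ k → 0 ≤ τ k j ∧ τ k j ≤ τbar * ω ^ (k - j)) :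
    TermSize E W κ N ∧
      NE9 E W κ (prodModuli ℓ fun _ => ω + 2 * B / (R₀ - s₀) * τbar) ∧
        FadingMemory (ℓ / (ω + 2 * B / (R₀ - s₀) * τbar)) (ω + 2 * B / (R₀ - s₀) * τbar)
          (prodModuli ℓ fun _ => ω + 2 * B / (R₀ - s₀) * τbar) := by
  have h𝒜R : ∀ k, 𝒜 k ⊆ ball (0 : Pot) R₀ := fun k Q hQ =>
    mem_ball_zero_iff.2 (lt_of_le_of_lt (mem_closedBall_zero_iff.1 (h𝒜 k hQ)) hsR)
  obtain ⟨hT, hocc⟩ := termSize_of_recursion_vacSub_potentialKPG G ρ U₀ explZ hAdm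
    (channelSizeNN_of_perStepNN hres hsum hstep) hfac hKP h𝒜R hdec hpin hΨv hexplZ hbase hNsucc hNnn hbox
  have hoccn : ∀ g ∈ W, ∀ g' ∈ W, ∀ k : ℕ, ‖ρ k (T k g' (E g))‖ ≤ s₀ := fun g hg g' hg' k =>
    mem_closedBall_zero_iff.1 (h𝒜 k (hocc g hg g' hg' k))
  exact ⟨hT, ne9_and_fadingMemory_of_potentialKPG_perStep_sharp_vac G ρ h0 hAdm hres hadd hsum hstep hfac hlast hKP hdec hpin hsR
    hρ hΨv hoccn hℓ hB hτbar hω hpos hlam hτ⟩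

end Pencil

/-! ## §4 Junction with the record: §3 at `Ψ := NE9EndApplied.ΨOf` -/

section Record

open Summit.QuantumFields.BalabanUV.T4Continuum.NE9EndApplied
open Summit.QuantumFields.BalabanUV.T4Continuum.NE9TableReading
open Summit.QuantumFields.BalabanUV.T4Continuum.NE9ComplexEncoding (doubleCarriers)

variable {C₀ : Carriers} {E : Type} {ι : Type}

/-- [folklore] **ROUTE R3′'s RECORD-SHAPE END AT `ΨOf` WITH THE OCCUPATION DERIVED** (reading `readingρ wt`): §3 at
`Ψ := NE9EndApplied.ΨOf G act wt U₀ explZ`, `hΨv` discharged by `rfl` — the twin of p256132's `ne9_and_fadingMemory_of_potentialKPG_psiOf` with `hocc`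
replaced by the size data and the box; `hlast` (D2) and the reading's 1-Lipschitz property `hρ` stay displayed. -/
theorem ne9_and_fadingMemory_of_potentialKPG_vacSub_sizeInduction_psiOf (G : ClusterGeom (doubleCarriers C₀))
    {Ef : Functional (doubleCarriers C₀) E} {W : Set (ℕ → ℝ)} {Adm : Set (E → (doubleCarriers C₀).Dom → ℝ)}
    {T : ℕ → (ℕ → ℝ) → (E → (doubleCarriers C₀).Dom → ℝ) → ι → ℝ} {κ s₀ R₀ B ℓ τbar ω : ℝ} {wt : ℕ → ι → ℝ}
    {τ : ℕ → ℕ → ℝ} {lam : ℕ → ℝ} {p₀ N : ℕ → ℝ} {act : ℕ → ℝ → E → lp (fun _ : ι => ℂ) ∞ → G.P → ℂ}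
    {𝒜 : ℕ → Set (lp (fun _ : ι => ℂ) ∞)} {m : ℕ → ℝ → E → G.P → ℝ} {a d : G.P → ℝ} {δ : (doubleCarriers C₀).Dom → ℝ}
    {U₀ : E} {explZ : ℕ → E → (doubleCarriers C₀).Dom → ℝ}
    (h0 : ScaleZeroFree Ef W) (hAdm : AdmissibleTerms Ef W Adm) (hres : AdmRestrict Adm)
    (hadd : ChannelAdditive Adm T) (hsum : ChannelStepSum Adm T) (hstep : ChannelSizeAtStepNN Adm T κ wt τ)
    (hfac : Factorises Ef W T (ΨOf G act wt U₀ explZ))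
    (hlast : LastCouplingLipschitz Ef W T (ΨOf G act wt U₀ explZ) κ lam) (hKP : G.PotentialKPG W act m a d R₀)
    (hdec : G.DecayExtract δ d) (hpin : G.PinBudget a δ (fun _ => B) κ) (hsR : s₀ < R₀)
    (h𝒜 : ∀ k, 𝒜 k ⊆ closedBall (0 : lp (fun _ : ι => ℂ) ∞) s₀)
    (hρ : ∀ (k : ℕ) (P P' : ι → ℝ) (M : ℝ), (∀ y, |P y - P' y| ≤ wt k y * M) →
      ‖readingρ wt k P - readingρ wt k P'‖ ≤ M)
    (hexplZ : ∀ (k : ℕ) (U : E) (X : (doubleCarriers C₀).Dom), (doubleCarriers C₀).scale X = k + 1 →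
      |explZ k U X| ≤ Real.exp (-(κ * (doubleCarriers C₀).d X)) * p₀ k)
    (hbase : ∀ g ∈ W, ∀ (U : E) (X : (doubleCarriers C₀).Dom), (doubleCarriers C₀).scale X = 0 →
      |Ef g U X| ≤ Real.exp (-(κ * (doubleCarriers C₀).d X)) * N 0)
    (hNsucc : ∀ j, p₀ j + 2 * B ≤ N (j + 1)) (hNnn : ∀ j, 0 ≤ N j)
    (hbox : ∀ (k : ℕ) (P : ι → ℝ), (∀ y, |P y| ≤ wt k y * sizeRadius τ N k) → readingρ wt k P ∈ 𝒜 k)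
    (hℓ : 0 ≤ ℓ) (hB : 0 ≤ B) (hτbar : 0 ≤ τbar) (hω : 0 ≤ ω) (hpos : 0 < ω + 2 * B / (R₀ - s₀) * τbar)
    (hlam : ∀ k, lam k ≤ ℓ) (hτ : ∀ k j, j ≤ k → 0 ≤ τ k j ∧ τ k j ≤ τbar * ω ^ (k - j)) :
    TermSize Ef W κ N ∧
      NE9 Ef W κ (prodModuli ℓ fun _ => ω + 2 * B / (R₀ - s₀) * τbar) ∧
        FadingMemory (ℓ / (ω + 2 * B / (R₀ - s₀) * τbar)) (ω + 2 * B / (R₀ - s₀) * τbar)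
          (prodModuli ℓ fun _ => ω + 2 * B / (R₀ - s₀) * τbar) :=
  ne9_and_fadingMemory_of_potentialKPG_vacSub_sizeInduction G (readingρ wt) U₀ explZ h0 hAdm hres hadd hsum hstep hfac hlast hKP
    hdec hpin hsR h𝒜 hρ (fun _ _ _ _ _ => rfl) hexplZ hbase hNsucc hNnn hbox hℓ hB hτbar hω hpos hlam hτ

end Record

end Summit.QuantumFields.BalabanUV.T4Continuum.NE9PencilSizeInduction

end
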